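import Summits.QuantumFields.QCD.Theorems.HeatSlicedQuarksRobustYangMillsHandoverTransferLevelOnePos
import Literature.MathematicalPhysics.QuantumLattice.SectorEigenvalueContinuation

/-!
# The fermionic transfer operator depends continuously on the bare masses, uniformly in the background
(crux `HeatSlicedQuarks.RobustYangMillsHandover`, item stmt-QuantumFields-8892, line `pin-the-infimum`;
helper towards the held stub `stub_spectralResponse`, mechanism step (ii): "continuity of the min–max levels
`qcdTransferLevel` in the bare mass at fixed `(k, S)`")

First of three files proving that, at fixed spatial torus and fixed `β ≥ 0`, Lüscher's finite-volume transfer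
levels `λ₀(m)`, `λ₁(m)` (`qcdTransferLevel`) and the gap `qcdTransferGap` are CONTINUOUS functions of the bare mass
tuple `m` on Lüscher's range `{m | ∀ f, m_f > −1}` — the a-priori regularity that the barrier argument of
`stub_spectralResponse` starts from (it does NOT give the volume-uniform modulus the stub asserts).  This file is the
matrix-analysis input, on the range viewed as the subtype `{m // ∀ f, −1 < m_f}`:

* `continuous_fermionSliceOp_joint` — `(U, m) ↦ T̂_F(U; m)` is jointly continuous (the inverse `A(U; m)⁻¹` in Smit's
  `M_F` is a genuine inverse on the range, `(det A)⁻¹ • adj A`);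
* `fermionSliceOp_entrySum_sub_small` — uniform closeness in the background: for every `m₀` in the range and
  `ε > 0`, eventually in `m → m₀`, `Σ_{s,t} ‖T̂_F(U; m)_{st} − T̂_F(U; m₀)_{st}‖ ≤ ε` for ALL `U` (compactness of the
  configuration space; currying into `C(SU(3)^E, ℂ)` with its sup metric);
* `fermionSliceOp_coercive_near` — uniform coercivity: some `c > 0` with `c · Re⟨v, v⟩ ≤ Re⟨v, T̂_F(U; m) v⟩` for all
  `U`, `v` and all `m` near `m₀` (minimum of the positive continuous form over the compact product of the
  configuration space with the unit sphere of the Fock space, then stability under `ε = c/2`).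

References: M. Reed, B. Simon, *Methods of Modern Mathematical Physics IV*, Thm XIII.1 [ReedSimonIV1978];
M. Lüscher, Commun. Math. Phys. 54 (1977) 283 [Luscher1977, pp. 283–292]; J. Smit, *Introduction to Quantum Fields on a
Lattice*, §6.5 (6.87)–(6.91) [Smit2023].  Pure theorem file.
-/

noncomputable section

namespace Summit.QuantumFields.QCD.Cruxes.RobustYangMillsHandover.PinTheInfimum

open scoped ComplexOrder ComplexConjugate Topology
open MeasureTheory Matrix Filter Literature.MathematicalPhysics.QuantumFieldTheory
  Literature.MathematicalPhysics.QuantumLattice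
open Summit.QuantumFields.QCD.Cruxes.StableActionBridge.Sketch

namespace TransferMassContinuity

variable {Nf S : ℕ} [NeZero S]

/-! ### Joint continuity in the background and the masses -/

omit [NeZero S] in
/-- `(U, m) ↦ A(U; m) = diag(m_f + 4) − ½ Σ_j (W_j(U) + W_j(U)ᴴ)` is jointly continuous. [folklore] -/
theorem continuous_sliceMassHop_joint :
    Continuous fun p : GaugeConfig 3 S (Matrix.specialUnitaryGroup (Fin 3) ℂ) × (Fin Nf → ℝ) =>
      sliceMassHop p.1 p.2 := by
  have hdiag : Continuous fun p : GaugeConfig 3 S (Matrix.specialUnitaryGroup (Fin 3) ℂ) × (Fin Nf → ℝ) =>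
      Matrix.diagonal fun q : SliceColourVar Nf S => ((p.2 q.1 + 4 : ℝ) : ℂ) := by
    refine Continuous.matrix_diagonal (continuous_pi fun q => ?_)
    exact Complex.continuous_ofReal.comp (((continuous_apply q.1).comp continuous_snd).add continuous_const)
  have hsum : Continuous fun p : GaugeConfig 3 S (Matrix.specialUnitaryGroup (Fin 3) ℂ) × (Fin Nf → ℝ) =>
      ∑ j : Fin 3, (colourHop (Nf := Nf) p.1 j + (colourHop p.1 j)ᴴ) :=
    continuous_finsetSum _ fun j _ =>
      ((FermionSliceContinuous.continuous_colourHop j).comp continuous_fst).fun_add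
        ((FermionSliceContinuous.continuous_colourHop j).comp continuous_fst).matrix_conjTranspose
  unfold sliceMassHop
  exact hdiag.fun_sub (hsum.fun_const_smul _)

/-- On Lüscher's range `(U, m) ↦ A(U; m)⁻¹ = (det A)⁻¹ • adj A` is jointly continuous. [folklore] -/
theorem continuous_sliceMassHop_inv_joint :
    Continuous fun p : GaugeConfig 3 S (Matrix.specialUnitaryGroup (Fin 3) ℂ) × {m : Fin Nf → ℝ // ∀ f, -1 < m f} =>
      (sliceMassHop p.1 p.2.1)⁻¹ := by
  have hA : Continuous fun p : GaugeConfig 3 S (Matrix.specialUnitaryGroup (Fin 3) ℂ) ×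
      {m : Fin Nf → ℝ // ∀ f, -1 < m f} => sliceMassHop p.1 p.2.1 :=
    continuous_sliceMassHop_joint.comp (continuous_fst.prodMk (continuous_subtype_val.comp continuous_snd))
  simp_rw [Matrix.inv_def, Ring.inverse_eq_inv]
  exact (hA.matrix_det.fun_inv₀ fun p =>
    FermionSliceContinuous.sliceMassHop_det_ne_zero p.1 p.2.1 p.2.2).fun_smul hA.matrix_adjugate

/-- On Lüscher's range `(U, m) ↦ M_F(U; m)` is jointly continuous. [cite: Smit2023, §6.5 (6.91)] -/
theorem continuous_fermionSliceMatrix_joint :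
    Continuous fun p : GaugeConfig 3 S (Matrix.specialUnitaryGroup (Fin 3) ℂ) × {m : Fin Nf → ℝ // ∀ f, -1 < m f} =>
      fermionSliceMatrix p.1 p.2.1 := by
  have hA : Continuous fun p : GaugeConfig 3 S (Matrix.specialUnitaryGroup (Fin 3) ℂ) ×
      {m : Fin Nf → ℝ // ∀ f, -1 < m f} => sliceMassHop p.1 p.2.1 :=
    continuous_sliceMassHop_joint.comp (continuous_fst.prodMk (continuous_subtype_val.comp continuous_snd))
  have hN : Continuous fun p : GaugeConfig 3 S (Matrix.specialUnitaryGroup (Fin 3) ℂ) ×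
      {m : Fin Nf → ℝ // ∀ f, -1 < m f} => sliceNilp (Nf := Nf) p.1 :=
    FermionSliceContinuous.continuous_sliceNilp.comp continuous_fst
  unfold fermionSliceMatrix
  exact ((continuous_const.fun_sub hN).matrix_mul
    ((FermionSliceContinuous.continuous_sliceKron continuous_sliceMassHop_inv_joint _).fun_add
      (FermionSliceContinuous.continuous_sliceKron hA _))).matrix_mul
    (continuous_const.fun_sub hN.matrix_conjTranspose)

/-- **`(U, m) ↦ T̂_F(U; m)` is jointly continuous on Lüscher's range.** [cite: Luscher1977, pp. 283–292] -/
theorem continuous_fermionSliceOp_joint :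
    Continuous fun p : GaugeConfig 3 S (Matrix.specialUnitaryGroup (Fin 3) ℂ) × {m : Fin Nf → ℝ // ∀ f, -1 < m f} =>
      fermionSliceOp p.1 p.2.1 := by
  have hA : Continuous fun p : GaugeConfig 3 S (Matrix.specialUnitaryGroup (Fin 3) ℂ) ×
      {m : Fin Nf → ℝ // ∀ f, -1 < m f} => sliceMassHop p.1 p.2.1 :=
    continuous_sliceMassHop_joint.comp (continuous_fst.prodMk (continuous_subtype_val.comp continuous_snd))
  unfold fermionSliceOp
  exact (hA.matrix_det.fun_pow 2).fun_smul
    (FermionSliceContinuous.continuous_fockLift (continuous_fermionSliceMatrix_joint.matrix_reindex _ _))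

/-! ### Uniform closeness in the background as the masses vary -/

omit [NeZero S] in
/-- A jointly continuous scalar function on `SU(3)^E × M` is, near each `m₀`, uniformly close in the compact
background variable: `∀ ε > 0, ∀ᶠ m → m₀, ∀ U, ‖F(U, m) − F(U, m₀)‖ < ε` (currying into `C(SU(3)^E, ℂ)` with the
sup metric). [folklore] -/
theorem eventually_forall_norm_sub_lt {M : Type*} [TopologicalSpace M]
    {F : GaugeConfig 3 S (Matrix.specialUnitaryGroup (Fin 3) ℂ) × M → ℂ} (hF : Continuous F) (m₀ : M)
    {ε : ℝ} (hε : 0 < ε) :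
    ∀ᶠ m in 𝓝 m₀, ∀ U, ‖F (U, m) - F (U, m₀)‖ < ε := by
  -- curry the swapped function into `C(SU(3)^E, ℂ)`; convergence there is uniform convergence
  set G : C(M × GaugeConfig 3 S (Matrix.specialUnitaryGroup (Fin 3) ℂ), ℂ) :=
    ⟨fun q => F (q.2, q.1), hF.comp (continuous_snd.prodMk continuous_fst)⟩ with hG
  have hT : Tendsto (fun m => G.curry m) (𝓝 m₀) (𝓝 (G.curry m₀)) := G.curry.continuous.continuousAt
  rw [ContinuousMap.tendsto_iff_tendstoUniformly, Metric.tendstoUniformly_iff] at hT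
  filter_upwards [hT ε hε] with m hm U
  have h := hm U
  rw [dist_comm, dist_eq_norm] at h
  exact h

/-- **Uniform closeness of `T̂_F(U; m)` to `T̂_F(U; m₀)` in the background**: for `m₀` in Lüscher's range and `ε > 0`,
eventually in `m → m₀` (within the range), `Σ_{s,t} ‖T̂_F(U; m)_{st} − T̂_F(U; m₀)_{st}‖ ≤ ε` for every `U`.
[cite: Luscher1977, pp. 283–292] -/
theorem fermionSliceOp_entrySum_sub_small (m₀ : {m : Fin Nf → ℝ // ∀ f, -1 < m f}) {ε : ℝ} (hε : 0 < ε) :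
    ∀ᶠ m in 𝓝 m₀, ∀ U : GaugeConfig 3 S (Matrix.specialUnitaryGroup (Fin 3) ℂ),
      ∑ s, ∑ t, ‖fermionSliceOp U m.1 s t - fermionSliceOp U m₀.1 s t‖ ≤ ε := by
  set d : ℕ := Fintype.card (Finset (SliceFermiIdx Nf S)) with hd
  have hd0 : 0 < (d : ℝ) := by exact_mod_cast Fintype.card_pos
  have hε' : 0 < ε / ((d : ℝ) * d) := div_pos hε (mul_pos hd0 hd0)
  -- each entry is uniformly close
  have hentry : ∀ s t : Finset (SliceFermiIdx Nf S), ∀ᶠ m in 𝓝 m₀,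
      ∀ U : GaugeConfig 3 S (Matrix.specialUnitaryGroup (Fin 3) ℂ),
        ‖fermionSliceOp U m.1 s t - fermionSliceOp U m₀.1 s t‖ < ε / ((d : ℝ) * d) := fun s t =>
    eventually_forall_norm_sub_lt ((continuous_fermionSliceOp_joint (Nf := Nf) (S := S)).matrix_elem s t) m₀ hε'
  have hall : ∀ᶠ m in 𝓝 m₀, ∀ s t : Finset (SliceFermiIdx Nf S),
      ∀ U : GaugeConfig 3 S (Matrix.specialUnitaryGroup (Fin 3) ℂ),
        ‖fermionSliceOp U m.1 s t - fermionSliceOp U m₀.1 s t‖ < ε / ((d : ℝ) * d) :=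
    eventually_all.mpr fun s => eventually_all.mpr fun t => hentry s t
  filter_upwards [hall] with m hm U
  calc ∑ s, ∑ t, ‖fermionSliceOp U m.1 s t - fermionSliceOp U m₀.1 s t‖
      ≤ ∑ _s : Finset (SliceFermiIdx Nf S), ∑ _t : Finset (SliceFermiIdx Nf S), ε / ((d : ℝ) * d) :=
        Finset.sum_le_sum fun s _ => Finset.sum_le_sum fun t _ => (hm s t U).le
    _ = ε := by
        rw [Finset.sum_const, Finset.sum_const, Finset.card_univ, nsmul_eq_mul, nsmul_eq_mul, ← hd]
        field_simp

/-- The entry sum `Σ_{s,t} ‖T̂_F(U; m₀)_{st}‖` is bounded uniformly in the background (continuity on the compact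
configuration space). [folklore] -/
theorem fermionSliceOp_entrySum_le (m₀ : {m : Fin Nf → ℝ // ∀ f, -1 < m f}) :
    ∃ B₀ : ℝ, ∀ U : GaugeConfig 3 S (Matrix.specialUnitaryGroup (Fin 3) ℂ),
      ∑ s, ∑ t, ‖fermionSliceOp U m₀.1 s t‖ ≤ B₀ := by
  have hc : Continuous fun U : GaugeConfig 3 S (Matrix.specialUnitaryGroup (Fin 3) ℂ) =>
      ∑ s, ∑ t, ‖fermionSliceOp U m₀.1 s t‖ :=
    continuous_finsetSum _ fun s _ => continuous_finsetSum _ fun t _ =>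
      ((continuous_fermionSliceOp Nf S m₀.1 m₀.2).matrix_elem s t).norm
  obtain ⟨B₀, hB₀⟩ := exists_bound_of_continuous_slice (S := S) hc
  exact ⟨B₀, fun U => (Real.le_norm_self _).trans (hB₀ U)⟩

/-- **Uniform entry bound near `m₀`**: some `B` bounds `Σ_{s,t} ‖T̂_F(U; m)_{st}‖` for all `U` and all `m` near `m₀`.
[folklore] -/
theorem fermionSliceOp_entrySum_le_near (m₀ : {m : Fin Nf → ℝ // ∀ f, -1 < m f}) :
    ∃ B : ℝ, 0 < B ∧ ∀ᶠ m in 𝓝 m₀, ∀ U : GaugeConfig 3 S (Matrix.specialUnitaryGroup (Fin 3) ℂ),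
      ∑ s, ∑ t, ‖fermionSliceOp U m.1 s t‖ ≤ B := by
  obtain ⟨B₀, hB₀⟩ := fermionSliceOp_entrySum_le (Nf := Nf) (S := S) m₀
  have hB₀0 : 0 ≤ B₀ := le_trans (Finset.sum_nonneg fun s _ => Finset.sum_nonneg fun t _ => norm_nonneg _)
    (hB₀ (Classical.arbitrary _))
  refine ⟨B₀ + 1, by linarith, ?_⟩
  filter_upwards [fermionSliceOp_entrySum_sub_small (S := S) m₀ one_pos] with m hm U
  have htri : ∀ s t : Finset (SliceFermiIdx Nf S),
      ‖fermionSliceOp U m.1 s t‖ ≤ ‖fermionSliceOp U m.1 s t - fermionSliceOp U m₀.1 s t‖ +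
        ‖fermionSliceOp U m₀.1 s t‖ := fun s t => norm_le_norm_sub_add _ _
  calc ∑ s, ∑ t, ‖fermionSliceOp U m.1 s t‖
      ≤ ∑ s, ∑ t, (‖fermionSliceOp U m.1 s t - fermionSliceOp U m₀.1 s t‖ + ‖fermionSliceOp U m₀.1 s t‖) :=
        Finset.sum_le_sum fun s _ => Finset.sum_le_sum fun t _ => htri s t
    _ = (∑ s, ∑ t, ‖fermionSliceOp U m.1 s t - fermionSliceOp U m₀.1 s t‖) +
          ∑ s, ∑ t, ‖fermionSliceOp U m₀.1 s t‖ := by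
        simp only [Finset.sum_add_distrib]
    _ ≤ 1 + B₀ := add_le_add (hm U) (hB₀ U)
    _ = B₀ + 1 := add_comm _ _

/-! ### Quadratic-form bounds by the entry sum -/

/-- `|⟨v, M v⟩| ≤ (Σ_{ij} ‖M_ij‖) · Re⟨v, v⟩` (norm version of the crude form bound). [folklore] -/
theorem norm_dotProduct_mulVec_le_entrySum {n : Type*} [Fintype n] (M : Matrix n n ℂ) (v : n → ℂ) :
    ‖star v ⬝ᵥ (M *ᵥ v)‖ ≤ (∑ i, ∑ j, ‖M i j‖) * (star v ⬝ᵥ v).re := by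
  have hexp : star v ⬝ᵥ (M *ᵥ v) = ∑ i, ∑ j, star (v i) * (M i j * v j) := by
    simp only [dotProduct, mulVec, Pi.star_apply, Finset.mul_sum]
  rw [hexp, PosSemidefRayleigh.re_star_dotProduct_self, Finset.sum_mul]
  refine (norm_sum_le _ _).trans (Finset.sum_le_sum fun i _ => ?_)
  rw [Finset.sum_mul]
  refine (norm_sum_le _ _).trans (Finset.sum_le_sum fun j _ => ?_)
  calc ‖star (v i) * (M i j * v j)‖ = ‖M i j‖ * (‖v i‖ * ‖v j‖) := by
        rw [norm_mul, norm_mul, norm_star]; ring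
    _ ≤ ‖M i j‖ * ∑ k, ‖v k‖ ^ 2 :=
        mul_le_mul_of_nonneg_left (PosSemidefRayleigh.norm_mul_norm_le_sum_sq v i j) (norm_nonneg _)

/-! ### Uniform coercivity near `m₀` -/

section FockSphere

variable {ι : Type*} [Fintype ι]

/-- The unit sphere `{Re⟨v,v⟩ = 1}` of a finite-dimensional complex coordinate space is compact. [folklore] -/
theorem isCompact_reSphere : IsCompact {v : ι → ℂ | (star v ⬝ᵥ v).re = 1} := by
  have hq : Continuous fun v : ι → ℂ => (star v ⬝ᵥ v).re :=
    Complex.continuous_re.comp (continuous_id.star.dotProduct continuous_id)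
  refine Metric.isCompact_of_isClosed_isBounded (isClosed_eq hq continuous_const) ?_
  refine (Metric.isBounded_iff_subset_closedBall (0 : ι → ℂ)).mpr ⟨1, fun v hv => ?_⟩
  have hv1 : ∑ k, ‖v k‖ ^ 2 = 1 := by rw [← PosSemidefRayleigh.re_star_dotProduct_self]; exact hv
  rw [Metric.mem_closedBall, dist_zero_right, pi_norm_le_iff_of_nonneg zero_le_one]
  intro s
  have hvs : ‖v s‖ ^ 2 ≤ 1 := hv1 ▸ Finset.single_le_sum (fun k _ => sq_nonneg ‖v k‖) (Finset.mem_univ s)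
  nlinarith [norm_nonneg (v s)]

/-- **Homogeneity**: a lower bound `c₀ ≤ Re⟨u, T u⟩` on the unit sphere `Re⟨u,u⟩ = 1` gives
`c₀ · Re⟨v, v⟩ ≤ Re⟨v, T v⟩` for every `v` (scale `v ≠ 0` by the real factor `(Re⟨v,v⟩)^{-1/2}`). [folklore] -/
theorem coercive_of_sphere_bound (T : Matrix ι ι ℂ) (c₀ : ℝ)
    (h : ∀ u : ι → ℂ, (star u ⬝ᵥ u).re = 1 → c₀ ≤ (star u ⬝ᵥ (T *ᵥ u)).re) (v : ι → ℂ) :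
    c₀ * (star v ⬝ᵥ v).re ≤ (star v ⬝ᵥ (T *ᵥ v)).re := by
  by_cases hv : v = 0
  · subst hv; simp
  have hr : 0 < (star v ⬝ᵥ v).re :=
    Literature.MathematicalPhysics.QuantumLattice.EigenvalueContinuation.re_star_dotProduct_self_pos hv
  set r : ℝ := (star v ⬝ᵥ v).re with hrdef
  set c : ℝ := (Real.sqrt r)⁻¹ with hcdef
  have hcc : c * c = r⁻¹ := by
    rw [hcdef, ← mul_inv, Real.mul_self_sqrt hr.le]
  have key : ∀ w : ι → ℂ, star ((c : ℂ) • v) ⬝ᵥ ((c : ℂ) • w) = ((c * c : ℝ) : ℂ) * (star v ⬝ᵥ w) := by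
    intro w
    rw [star_smul, Complex.star_def, Complex.conj_ofReal, smul_dotProduct, dotProduct_smul, smul_smul,
      smul_eq_mul, Complex.ofReal_mul]
  have hu : (star ((c : ℂ) • v) ⬝ᵥ ((c : ℂ) • v)).re = 1 := by
    rw [key v, hcc, Complex.re_ofReal_mul, ← hrdef, inv_mul_cancel₀ hr.ne']
  have hmin := h ((c : ℂ) • v) hu
  rw [Matrix.mulVec_smul, key, hcc, Complex.re_ofReal_mul, le_inv_mul_iff₀ hr] at hmin
  linarith [hmin]

end FockSphere

/-- The real quadratic form `(U, v) ↦ Re⟨v, T̂_F(U; m₀) v⟩` attains a strictly positive minimum `c₀` on the compact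
product of the configuration space with the unit sphere `{Re⟨v,v⟩ = 1}` of the Fock space (`T̂_F(U; m₀) > 0`
pointwise); hence `c₀ · Re⟨v, v⟩ ≤ Re⟨v, T̂_F(U; m₀) v⟩` for all `U`, `v`. [cite: Luscher1977, pp. 283–292] -/
theorem fermionSliceOp_coercive_at (m₀ : {m : Fin Nf → ℝ // ∀ f, -1 < m f}) :
    ∃ c₀ : ℝ, 0 < c₀ ∧ ∀ (U : GaugeConfig 3 S (Matrix.specialUnitaryGroup (Fin 3) ℂ))
      (v : Fock (SliceFermiIdx Nf S)), c₀ * (star v ⬝ᵥ v).re ≤ (star v ⬝ᵥ (fermionSliceOp U m₀.1 *ᵥ v)).re := by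
  set Sph : Set (Fock (SliceFermiIdx Nf S)) := {v | (star v ⬝ᵥ v).re = 1} with hSph
  have hK : IsCompact ((Set.univ : Set (GaugeConfig 3 S (Matrix.specialUnitaryGroup (Fin 3) ℂ))) ×ˢ Sph) :=
    isCompact_univ.prod isCompact_reSphere
  -- non-empty: the vacuum is a unit vector
  have hvac : (vacuum : Fock (SliceFermiIdx Nf S)) ∈ Sph := by
    show (star (vacuum : Fock (SliceFermiIdx Nf S)) ⬝ᵥ vacuum).re = 1
    have h1 : star (vacuum : Fock (SliceFermiIdx Nf S)) ⬝ᵥ (vacuum : Fock (SliceFermiIdx Nf S)) = 1 := by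
      simpa using TransferVacuumRayleigh.star_smul_vacuum_dotProduct (Nf := Nf) (S := S) 1 1
    rw [h1, Complex.one_re]
  have hKne : ((Set.univ : Set (GaugeConfig 3 S (Matrix.specialUnitaryGroup (Fin 3) ℂ))) ×ˢ Sph).Nonempty :=
    ⟨(Classical.arbitrary _, vacuum), Set.mem_univ _, hvac⟩
  -- the form is jointly continuous
  have hform : Continuous fun p : GaugeConfig 3 S (Matrix.specialUnitaryGroup (Fin 3) ℂ) × Fock (SliceFermiIdx Nf S) =>
      (star p.2 ⬝ᵥ (fermionSliceOp p.1 m₀.1 *ᵥ p.2)).re :=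
    Complex.continuous_re.comp (continuous_snd.star.dotProduct
      (((continuous_fermionSliceOp Nf S m₀.1 m₀.2).comp continuous_fst).matrix_mulVec continuous_snd))
  obtain ⟨p₀, hp₀, hmin⟩ := hK.exists_isMinOn hKne hform.continuousOn
  obtain ⟨-, hv₀⟩ := hp₀
  have hv₀ne : p₀.2 ≠ 0 := by
    intro h
    have h1 : (star p₀.2 ⬝ᵥ p₀.2).re = 1 := hv₀
    rw [h] at h1
    simp at h1
  refine ⟨(star p₀.2 ⬝ᵥ (fermionSliceOp p₀.1 m₀.1 *ᵥ p₀.2)).re, ?_, fun U v => ?_⟩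
  · have h := (fermionSliceOp_posDef Nf S p₀.1 m₀.1 m₀.2).re_dotProduct_pos hv₀ne
    simpa using h
  · refine coercive_of_sphere_bound (fermionSliceOp U m₀.1) _ (fun u hu => ?_) v
    exact hmin (Set.mk_mem_prod (Set.mem_univ U) hu)

/-- **Uniform coercivity of `T̂_F(U; m)` near `m₀`**: there is `c > 0` such that for all `m` near `m₀` (within Lüscher's
range), all backgrounds `U` and all Fock vectors `v`, `c · Re⟨v, v⟩ ≤ Re⟨v, T̂_F(U; m) v⟩` (take `c = c₀/2` and
`Σ‖ΔT̂_F‖ ≤ c₀/2`). [cite: Luscher1977, pp. 283–292] -/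
theorem fermionSliceOp_coercive_near (m₀ : {m : Fin Nf → ℝ // ∀ f, -1 < m f}) :
    ∃ c : ℝ, 0 < c ∧ ∀ᶠ m in 𝓝 m₀, ∀ (U : GaugeConfig 3 S (Matrix.specialUnitaryGroup (Fin 3) ℂ))
      (v : Fock (SliceFermiIdx Nf S)), c * (star v ⬝ᵥ v).re ≤ (star v ⬝ᵥ (fermionSliceOp U m.1 *ᵥ v)).re := by
  obtain ⟨c₀, hc₀, hco⟩ := fermionSliceOp_coercive_at (Nf := Nf) (S := S) m₀
  refine ⟨c₀ / 2, by positivity, ?_⟩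
  filter_upwards [fermionSliceOp_entrySum_sub_small (S := S) m₀ (half_pos hc₀)] with m hm U v
  have hdiff : star v ⬝ᵥ (fermionSliceOp U m.1 *ᵥ v) =
      star v ⬝ᵥ (fermionSliceOp U m₀.1 *ᵥ v) + star v ⬝ᵥ ((fermionSliceOp U m.1 - fermionSliceOp U m₀.1) *ᵥ v) := by
    rw [Matrix.sub_mulVec, dotProduct_sub]; ring
  have hbound := norm_dotProduct_mulVec_le_entrySum (fermionSliceOp U m.1 - fermionSliceOp U m₀.1) v
  have hre : -((∑ i, ∑ j, ‖(fermionSliceOp U m.1 - fermionSliceOp U m₀.1) i j‖) * (star v ⬝ᵥ v).re) ≤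
      (star v ⬝ᵥ ((fermionSliceOp U m.1 - fermionSliceOp U m₀.1) *ᵥ v)).re :=
    (neg_le_neg hbound).trans (neg_le.mp ((Complex.neg_re _ ▸ Complex.re_le_norm (-_)).trans_eq (norm_neg _)))
  have hsum : ∑ i, ∑ j, ‖(fermionSliceOp U m.1 - fermionSliceOp U m₀.1) i j‖ ≤ c₀ / 2 := by
    simpa only [Matrix.sub_apply] using hm U
  have hvv : 0 ≤ (star v ⬝ᵥ v).re := by
    rw [PosSemidefRayleigh.re_star_dotProduct_self]; exact Finset.sum_nonneg fun k _ => sq_nonneg _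
  rw [hdiff, Complex.add_re]
  nlinarith [hco U v, mul_le_mul_of_nonneg_right hsum hvv]

end TransferMassContinuity

/-- **`T̂_F(U; m)` depends continuously on the bare masses, uniformly in the background** (registered sub-goal
`fermionSliceOp_mass_uniform` of crux stmt-QuantumFields-8892, line `pin-the-infimum`): for every mass tuple `m₀` in
Lüscher's range, (i) for every `ε > 0`, eventually as `m → m₀` within the range, `Σ_{s,t} ‖T̂_F(U;m)_{st} − T̂_F(U;m₀)_{st}‖ ≤ ε`
for all `U`; (ii) some `c > 0` has `c·Re⟨v,v⟩ ≤ Re⟨v, T̂_F(U;m)v⟩` for all `U`, `v` and all `m` near `m₀`.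
[cite: Luscher1977, pp. 283–292] [cite: Smit2023, §6.5 (6.87)–(6.91)] -/
theorem fermionSliceOp_mass_uniform : ∀ (Nf S : ℕ) [NeZero S] (m₀ : {m : Fin Nf → ℝ // ∀ f, -1 < m f}), (∀ ε : ℝ, 0 < ε → ∀ᶠ m in 𝓝 m₀, ∀ U : GaugeConfig 3 S (Matrix.specialUnitaryGroup (Fin 3) ℂ), ∑ s, ∑ t, ‖fermionSliceOp U m.1 s t - fermionSliceOp U m₀.1 s t‖ ≤ ε) ∧ ∃ c : ℝ, 0 < c ∧ ∀ᶠ m in 𝓝 m₀, ∀ (U : GaugeConfig 3 S (Matrix.specialUnitaryGroup (Fin 3) ℂ)) (v : Fock (SliceFermiIdx Nf S)), c * (star v ⬝ᵥ v).re ≤ (star v ⬝ᵥ (fermionSliceOp U m.1 *ᵥ v)).re :=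
  fun _ _ _ m₀ => ⟨fun _ hε => TransferMassContinuity.fermionSliceOp_entrySum_sub_small m₀ hε,
    TransferMassContinuity.fermionSliceOp_coercive_near m₀⟩

end Summit.QuantumFields.QCD.Cruxes.RobustYangMillsHandover.PinTheInfimum

end
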